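import Mathlib
import Literature.RepresentationTheory.SymmetricPowerBinaryForms
import HarnessLib

/-!
# `SteinbergArtinDedekind.SteinbergCongruence` (stmt-Langlands-11804), part 1 of 3: `charpoly Sym^r`

Support lemmas (pure linear algebra over a field `k`) for the proof of
`Summit.Langlands.Langlands.Theses.SteinbergArtinDedekind.SteinbergCongruence` (part 3,
`SteinbergArtinDedekindSteinbergCongruence.lean`): for a `2 × 2` matrix `y` with
`charpoly y = (X − a)(X − b)`, the `r`-th symmetric power `Sym^r y` (the tree's
`Literature.RepresentationTheory.symPow`, acting on binary forms of degree `r`) has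
`charpoly (Sym^r y) = ∏_{i=0}^{r} (X − a^i b^{r−i})` in ANY basis — triangularise `y` explicitly (three
cases), conjugation invariance by functoriality of `Sym^r` on the matrix monoid, and the upper-triangular
action on the monomial basis `X₀^{r−j} X₁^{j}` read through the coordinates `F ↦ coeff_i F(1, X)`
(`dehom₁`).  Theorems only; no `sorry`; axioms `propext`, `Classical.choice`, `Quot.sound`.
-/

set_option linter.dupNamespace false -- project-wide option; `Summit.Langlands.Langlands.Theorems` is the mandated namespace, one namespace for the three parts

namespace Summit.Langlands.Langlands.Theorems.SteinbergArtinDedekindSteinbergCongruence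

open Polynomial Matrix

/-! ### C. Binary forms of degree `r`: the symmetric power `Sym^r` of a `2 × 2` matrix

`charpoly (Sym^r y) = ∏_{i=0}^{r} (X − a^i b^{r−i})` whenever `charpoly y = (X − a)(X − b)` (`k` a field):
triangularise `y` (three explicit cases), conjugation invariance, and the upper-triangular action on the
monomial basis `X₀^{r−j} X₁^{j}` read through the coordinates `F ↦ coeff_i F(1, X)`. -/

section BinaryForms

open Literature.RepresentationTheory

variable {k : Type*} [Field k] (r : ℕ)

/-- The monomials `X₀^{r-j} X₁^{j}` are binary forms of degree `r`. [folklore] -/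
theorem monomial_mem_homogeneousSubmodule (j : Fin (r + 1)) :
    (MvPolynomial.X 0 ^ (r - (j : ℕ)) * MvPolynomial.X 1 ^ (j : ℕ) : MvPolynomial (Fin 2) k) ∈
      MvPolynomial.homogeneousSubmodule (Fin 2) k r := by
  rw [MvPolynomial.mem_homogeneousSubmodule]
  have h := ((MvPolynomial.isHomogeneous_X k (0 : Fin 2)).pow (r - (j : ℕ))).mul
    ((MvPolynomial.isHomogeneous_X k (1 : Fin 2)).pow (j : ℕ))
  have hj : (j : ℕ) ≤ r := Nat.lt_succ_iff.mp j.is_lt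
  convert h using 1
  rw [one_mul, one_mul, Nat.sub_add_cancel hj]

/-- `F(1, X)` of the monomial `X₀^{r-j} X₁^{j}` is `X^j`. [folklore] -/
theorem dehom₁_monomial (j : Fin (r + 1)) :
    dehom₁ (MvPolynomial.X 0 ^ (r - (j : ℕ)) * MvPolynomial.X 1 ^ (j : ℕ) : MvPolynomial (Fin 2) k) =
      Polynomial.X ^ (j : ℕ) := by
  rw [map_mul, map_pow, map_pow, dehom₁_X_zero, dehom₁_X_one, one_pow, one_mul]

/-- **A coordinate basis of binary forms**: `V_r` has a basis `m_j = X₀^{r−j} X₁^{j}` (`0 ≤ j ≤ r`) whose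
coordinate functionals are `F ↦ coeff_i F(1, X)`. [folklore] -/
theorem exists_basis_binaryForms :
    ∃ b : Module.Basis (Fin (r + 1)) k (MvPolynomial.homogeneousSubmodule (Fin 2) k r),
      (∀ (F : MvPolynomial.homogeneousSubmodule (Fin 2) k r) (i : Fin (r + 1)),
          b.repr F i = (dehom₁ (F : MvPolynomial (Fin 2) k)).coeff i) ∧
        ∀ j : Fin (r + 1), ((b j : MvPolynomial.homogeneousSubmodule (Fin 2) k r) : MvPolynomial (Fin 2) k)
          = MvPolynomial.X 0 ^ (r - (j : ℕ)) * MvPolynomial.X 1 ^ (j : ℕ) := by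
  classical
  set V := MvPolynomial.homogeneousSubmodule (Fin 2) k r
  let φ : V →ₗ[k] (Fin (r + 1) → k) :=
    { toFun := fun F i => (dehom₁ (F : MvPolynomial (Fin 2) k)).coeff i
      map_add' := fun F F' => by
        funext i
        simp only [Submodule.coe_add, map_add, Polynomial.coeff_add, Pi.add_apply]
      map_smul' := fun c F => by
        funext i
        simp only [Submodule.coe_smul, map_smul, Polynomial.coeff_smul, Pi.smul_apply,
          RingHom.id_apply] }
  let m : Fin (r + 1) → V := fun j => ⟨_, monomial_mem_homogeneousSubmodule (k := k) r j⟩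
  have hφm : ∀ j, φ (m j) = Pi.single j 1 := by
    intro j
    funext i
    change (dehom₁ (MvPolynomial.X 0 ^ (r - (j : ℕ)) * MvPolynomial.X 1 ^ (j : ℕ) :
      MvPolynomial (Fin 2) k)).coeff i = _
    rw [dehom₁_monomial, Polynomial.coeff_X_pow, Pi.single_apply]
    simp only [Fin.ext_iff]
  have hinj : Function.Injective φ := by
    rw [← LinearMap.ker_eq_bot, LinearMap.ker_eq_bot']
    intro F hF
    have hdeg := natDegree_dehom₁_le F.2
    have hzero : dehom₁ (F : MvPolynomial (Fin 2) k) = 0 := by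
      ext i
      rw [Polynomial.coeff_zero]
      by_cases hi : i ≤ r
      · have := congrFun hF ⟨i, Nat.lt_succ_of_le hi⟩
        exact this
      · exact Polynomial.coeff_eq_zero_of_natDegree_lt (lt_of_le_of_lt hdeg (not_le.mp hi))
    exact Subtype.ext (eq_zero_of_dehom₁_eq_zero F.2 hzero)
  have hsurj : Function.Surjective φ := by
    intro c
    refine ⟨∑ j, c j • m j, ?_⟩
    rw [map_sum]
    simp_rw [map_smul, hφm]
    funext i
    simp [Finset.sum_apply, Pi.single_apply]
  let e : V ≃ₗ[k] (Fin (r + 1) → k) := LinearEquiv.ofBijective φ ⟨hinj, hsurj⟩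
  refine ⟨Module.Basis.ofEquivFun e, fun F i => by rw [Module.Basis.ofEquivFun_repr_apply]; rfl,
    fun j => ?_⟩
  have : (Module.Basis.ofEquivFun e) j = m j := by
    rw [Module.Basis.coe_ofEquivFun]
    apply e.injective
    rw [LinearEquiv.apply_symm_apply]
    exact (hφm j).symm
  rw [this]

variable {r}

/-- The matrix of `Sym^r` of an UPPER-triangular `u = (α c; 0 β)` on the coordinate basis:
entry `(i, j)` is `coeff_i ((α)^{r−j} (β X + c)^j)`. [folklore] -/
theorem toMatrix_symPow_upper (b : Module.Basis (Fin (r + 1)) k (MvPolynomial.homogeneousSubmodule (Fin 2) k r))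
    (hb : ∀ (F : MvPolynomial.homogeneousSubmodule (Fin 2) k r) (i : Fin (r + 1)),
      b.repr F i = (dehom₁ (F : MvPolynomial (Fin 2) k)).coeff i)
    (hb' : ∀ j : Fin (r + 1), ((b j : MvPolynomial.homogeneousSubmodule (Fin 2) k r) : MvPolynomial (Fin 2) k)
      = MvPolynomial.X 0 ^ (r - (j : ℕ)) * MvPolynomial.X 1 ^ (j : ℕ))
    (α β c : k) (i j : Fin (r + 1)) :
    LinearMap.toMatrix b b (symPow r !![α, c; 0, β]) i j =
      (Polynomial.C α ^ (r - (j : ℕ)) * (Polynomial.C β * Polynomial.X + Polynomial.C c) ^ (j : ℕ)).coeff i := by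
  have h0 : dehom₁ (mvPolynomialSubst !![α, c; 0, β] (MvPolynomial.X 0 : MvPolynomial (Fin 2) k)) =
      Polynomial.C α := by
    rw [mvPolynomialSubst_X, Fin.sum_univ_two]
    simp
  have h1 : dehom₁ (mvPolynomialSubst !![α, c; 0, β] (MvPolynomial.X 1 : MvPolynomial (Fin 2) k)) =
      Polynomial.C β * Polynomial.X + Polynomial.C c := by
    rw [mvPolynomialSubst_X, Fin.sum_univ_two]
    simp
    ring
  rw [LinearMap.toMatrix_apply, hb, coe_symPow_apply, hb' j, map_mul, map_pow, map_pow, map_mul, map_pow,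
    map_pow, h0, h1]

/-- **`Sym^r` of an upper-triangular matrix**: `charpoly (Sym^r (α c; 0 β)) = ∏_{i=0}^{r} (X − α^i β^{r−i})`.
[folklore] -/
theorem charpoly_toMatrix_symPow_upper
    (b : Module.Basis (Fin (r + 1)) k (MvPolynomial.homogeneousSubmodule (Fin 2) k r))
    (hb : ∀ (F : MvPolynomial.homogeneousSubmodule (Fin 2) k r) (i : Fin (r + 1)),
      b.repr F i = (dehom₁ (F : MvPolynomial (Fin 2) k)).coeff i)
    (hb' : ∀ j : Fin (r + 1), ((b j : MvPolynomial.homogeneousSubmodule (Fin 2) k r) : MvPolynomial (Fin 2) k)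
      = MvPolynomial.X 0 ^ (r - (j : ℕ)) * MvPolynomial.X 1 ^ (j : ℕ))
    (α β c : k) :
    (LinearMap.toMatrix b b (symPow r !![α, c; 0, β])).charpoly =
      ∏ i ∈ Finset.range (r + 1), (X - C (α ^ i * β ^ (r - i))) := by
  have hlin : (Polynomial.C β * Polynomial.X + Polynomial.C c).natDegree ≤ 1 := Polynomial.natDegree_linear_le
  have hdeg : ∀ j : Fin (r + 1),
      (Polynomial.C α ^ (r - (j : ℕ)) * (Polynomial.C β * Polynomial.X + Polynomial.C c) ^ (j : ℕ)).natDegree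
        ≤ (j : ℕ) := by
    intro j
    refine Polynomial.natDegree_mul_le.trans ?_
    have h1 : (Polynomial.C α ^ (r - (j : ℕ))).natDegree = 0 := by
      rw [← Polynomial.C_pow, Polynomial.natDegree_C]
    have h2 : ((Polynomial.C β * Polynomial.X + Polynomial.C c) ^ (j : ℕ)).natDegree ≤ (j : ℕ) := by
      refine Polynomial.natDegree_pow_le.trans ?_
      calc (j : ℕ) * (Polynomial.C β * Polynomial.X + Polynomial.C c).natDegree ≤ (j : ℕ) * 1 :=
            Nat.mul_le_mul_left _ hlin
        _ = (j : ℕ) := mul_one _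
    omega
  have htri : ((LinearMap.toMatrix b b (symPow r !![α, c; 0, β]))).BlockTriangular id := by
    intro i j hij
    rw [toMatrix_symPow_upper b hb hb']
    exact Polynomial.coeff_eq_zero_of_natDegree_lt (lt_of_le_of_lt (hdeg j) hij)
  rw [Matrix.charpoly_of_upperTriangular _ htri]
  have hdiag : ∀ j : Fin (r + 1),
      LinearMap.toMatrix b b (symPow r !![α, c; 0, β]) j j = α ^ (r - (j : ℕ)) * β ^ (j : ℕ) := by
    intro j
    rw [toMatrix_symPow_upper b hb hb', ← Polynomial.C_pow, Polynomial.coeff_C_mul]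
    have := Polynomial.coeff_pow_of_natDegree_le (m := (j : ℕ)) hlin
    rw [mul_one] at this
    rw [this]
    simp
  simp_rw [hdiag]
  rw [Fin.prod_univ_eq_prod_range (fun j => X - C (α ^ (r - j) * β ^ j)) (r + 1),
    ← Finset.prod_range_reflect]
  refine Finset.prod_congr rfl fun j hj => ?_
  have hj' : j ≤ r := Nat.lt_succ_iff.mp (Finset.mem_range.mp hj)
  rw [Nat.add_sub_cancel, Nat.sub_sub_self hj']

/-- **Conjugation invariance**: if `y P = P u` with `P` invertible then `Sym^r y` and `Sym^r u` have the
same characteristic polynomial (functoriality of `Sym^r` on the matrix monoid). [folklore] -/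
theorem charpoly_toMatrix_symPow_eq_of_semiconj {ι : Type*} [Fintype ι] [DecidableEq ι]
    (b : Module.Basis ι k (MvPolynomial.homogeneousSubmodule (Fin 2) k r))
    (y u P : Matrix (Fin 2) (Fin 2) k) (hP : IsUnit P.det) (h : y * P = P * u) :
    (LinearMap.toMatrix b b (symPow r y)).charpoly = (LinearMap.toMatrix b b (symPow r u)).charpoly := by
  set S := symPow (σ := Fin 2) (R := k) r with hS
  have hPP : P * P⁻¹ = 1 := Matrix.mul_nonsing_inv P hP
  have hPP' : P⁻¹ * P = 1 := Matrix.nonsing_inv_mul P hP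
  have hM' : LinearMap.toMatrix b b (S P⁻¹) * LinearMap.toMatrix b b (S P) = 1 := by
    rw [← LinearMap.toMatrix_mul, ← map_mul, hPP', map_one, LinearMap.toMatrix_one]
  have hy : S y = S P * S u * S P⁻¹ := by
    rw [← map_mul, ← h, map_mul, mul_assoc, ← map_mul, hPP, map_one, mul_one]
  rw [hy, LinearMap.toMatrix_mul, LinearMap.toMatrix_mul, Matrix.charpoly_mul_comm, ← mul_assoc, hM',
    one_mul]

/-- **Triangularisation of a `2 × 2` matrix with split characteristic polynomial** (explicit, three cases):
`y P = P (a c; 0 b)` for some invertible `P`. [folklore] -/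
theorem exists_semiconj_upper (y : Matrix (Fin 2) (Fin 2) k) (a b : k)
    (hy : y.charpoly = (X - C a) * (X - C b)) :
    ∃ (P : Matrix (Fin 2) (Fin 2) k) (c : k), IsUnit P.det ∧ y * P = P * !![a, c; 0, b] := by
  obtain ⟨p, q, r', s, rfl⟩ : ∃ p q r' s : k, y = !![p, q; r', s] := ⟨_, _, _, _, y.eta_fin_two⟩
  have e : (X - C a) * (X - C b) = X ^ 2 - (C a + C b) * X + C a * C b := by ring
  have htr : p + s = a + b := by
    have h := Matrix.trace_eq_neg_charpoly_coeff !![p, q; r', s]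
    rw [hy, e, Matrix.trace_fin_two_of] at h
    simp at h
    linear_combination h
  have hdet : p * s - q * r' = a * b := by
    have h := Matrix.det_eq_sign_charpoly_coeff !![p, q; r', s]
    rw [hy, e, Matrix.det_fin_two_of] at h
    simp at h
    linear_combination h
  by_cases hq : q = 0
  · subst hq
    -- the swap case, used twice
    have swap_case : p = b → s = a → ∃ (P : Matrix (Fin 2) (Fin 2) k) (c : k),
        IsUnit P.det ∧ !![p, 0; r', s] * P = P * !![a, c; 0, b] := by
      intro hp hs
      refine ⟨!![0, 1; 1, 0], r', ?_, ?_⟩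
      · rw [Matrix.det_fin_two_of]; simp
      · subst hp; subst hs
        ext i j
        fin_cases i <;> fin_cases j <;>
          simp only [Matrix.mul_apply, Fin.sum_univ_two, Matrix.of_apply, Matrix.cons_val',
            Matrix.cons_val_zero, Matrix.cons_val_one, Matrix.empty_val', Matrix.cons_val_fin_one,
            Fin.isValue, Fin.zero_eta, Fin.mk_one] <;>
          ring
    have hp : (p - a) * (p - b) = 0 := by linear_combination p * htr - hdet
    rcases mul_eq_zero.mp hp with hp | hp
    · have hpa : p = a := sub_eq_zero.mp hp
      by_cases hab : a = b
      · exact swap_case (hpa.trans hab) (by linear_combination htr - hpa - hab)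
      · refine ⟨!![b - a, 0; -r', 1], 0, ?_, ?_⟩
        · rw [Matrix.det_fin_two_of, isUnit_iff_ne_zero]
          intro h; apply hab; linear_combination -h
        · have hs : s = b := by linear_combination htr - hpa
          subst hpa; subst hs
          ext i j
          fin_cases i <;> fin_cases j <;>
            simp only [Matrix.mul_apply, Fin.sum_univ_two, Matrix.of_apply, Matrix.cons_val',
              Matrix.cons_val_zero, Matrix.cons_val_one, Matrix.empty_val', Matrix.cons_val_fin_one,
              Fin.isValue, Fin.zero_eta, Fin.mk_one] <;>
            ring
    · exact swap_case (sub_eq_zero.mp hp) (by linear_combination htr - sub_eq_zero.mp hp)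
  · refine ⟨!![q, 0; a - p, 1], 1, ?_, ?_⟩
    · rw [Matrix.det_fin_two_of, isUnit_iff_ne_zero]
      intro h; apply hq; linear_combination h
    · ext i j
      fin_cases i <;> fin_cases j <;>
        simp only [Matrix.mul_apply, Fin.sum_univ_two, Matrix.of_apply, Matrix.cons_val',
          Matrix.cons_val_zero, Matrix.cons_val_one, Matrix.empty_val', Matrix.cons_val_fin_one,
          Fin.isValue, Fin.zero_eta, Fin.mk_one]
      · ring
      · ring
      · linear_combination a * htr - hdet
      · linear_combination htr

/-- **`charpoly (Sym^r y) = ∏_{i=0}^{r} (X − a^i b^{r−i})`** for every `2 × 2` matrix `y` over a field with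
`charpoly y = (X − a)(X − b)` (Sym^r of the standard representation has "eigenvalues" `a^i b^{r-i}`).
[cite: Humphreys2005, §19.2 p.198] -/
theorem charpoly_toMatrix_symPow
    (bs : Module.Basis (Fin (r + 1)) k (MvPolynomial.homogeneousSubmodule (Fin 2) k r))
    (hb : ∀ (F : MvPolynomial.homogeneousSubmodule (Fin 2) k r) (i : Fin (r + 1)),
      bs.repr F i = (dehom₁ (F : MvPolynomial (Fin 2) k)).coeff i)
    (hb' : ∀ j : Fin (r + 1), ((bs j : MvPolynomial.homogeneousSubmodule (Fin 2) k r) : MvPolynomial (Fin 2) k)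
      = MvPolynomial.X 0 ^ (r - (j : ℕ)) * MvPolynomial.X 1 ^ (j : ℕ))
    (y : Matrix (Fin 2) (Fin 2) k) (a b : k) (hy : y.charpoly = (X - C a) * (X - C b)) :
    (LinearMap.toMatrix bs bs (symPow r y)).charpoly =
      ∏ i ∈ Finset.range (r + 1), (X - C (a ^ i * b ^ (r - i))) := by
  obtain ⟨P, c, hP, h⟩ := exists_semiconj_upper y a b hy
  rw [charpoly_toMatrix_symPow_eq_of_semiconj bs y _ P hP h, charpoly_toMatrix_symPow_upper bs hb hb']

end BinaryForms

end Summit.Langlands.Langlands.Theorems.SteinbergArtinDedekindSteinbergCongruence
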